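import Summits.QuantumFields.BalabanUV.Beta.GAN24.LambdaSectorSourcePairingZero
import Summits.QuantumFields.BalabanUV.Beta.GAN24.SrecLinearPartEq
import Summits.QuantumFields.BalabanUV.Beta.SpineRootedS0N

/-!
# `BalabanUV.Beta.GAN24.SourcePairingLevelOneSectors` — binder row G-an2-4 ∕ (CONV-C), the (S) row ∕ (W-γ) one level up, the (η) step at the base, PART 1:
# **THE SOURCE PAIRING AT LEVEL ONE SPLITS INTO ITS THREE SECTORS — `X_1(h; n, φ)[S0NAt ρ cE cVH cΛ] = cE·X_1[wilsonA] + cVH·X_1[vhSAt ρ] + cΛ·X_1[SΛ_0]`**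
# (G-an2-4 CRUX TEAM (2), seat `b2b-balaban-gan24-formalise-leaf-06` = the (γ) hand, gen 50, INTENT 3, PART 1)

NOT IN PRINT; OUR BOOKKEEPING ([folklore] linearity + summability bookkeeping BY NAME over leaf-01∕road-S's `SrecLinearPartEq.e3K_add` and `ThirdJetKernel.e3K_smul` (the cubic functional
is additive on local stencil families and homogeneous), an2's `ValueJetGeneric.locStencil_e3OfK`, `StepJetData.locStencil_wilsonA`, an1's `AveragingHessianKernelsRooted.locStencil_vhSAt`,
TODAY's `LambdaMemberPairing.locStencil_SLam_lamCoeffK` and `LambdaSectorSourcePairingZero.SLam_lamCoeffOf_eq_SLam_lamCoeffK_zero` (the Lagrange member of `S0NAt` in the `lamCoeffK`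
letters); 0 `def`, 0 cited fact, 0 `def … : Prop`, 0 sorry).
HONEST FRAMING (cell contract, verbatim): «discharging `BetaPertH` makes Bałaban's UV stability UNCONDITIONAL — a real constructive-QFT result; it is NOT the continuum limit and NOT
the Clay problem.»  HONEST DEPENDENCY (verbatim): «continuum YM on T⁴ ⇐ BetaPertH ∧ nine spine estimates (0/9 proved); BetaPertH ⇐ (D1) ∧ (D4) ∧ CAP+tail; G-an2-4 gates asym,
D1 and NE2/3/4.»

WHY.  B″'s source pairing one level up at the base level is `X_1(h; n, φ) = Σ_l Σ'_t h l t·Σ'_{(u,x)} Σ_κ Σ_κ₂ n κ u·dzφ κ₂ x·e3OfK Lc G_0 (SrecAt 0) l t u x (inl κ)(inl κ₂)` with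
`SrecAt 0 = S0NAt ρ cE cVH cΛ = cE•wilsonA + cVH•vhSAt ρ + cΛ•SLam Lc (lamCoeffOf (KInv Lc) Lc) (hessFFAt ρ)`.  The three members are local stencil families, the cubic functional
`S ↦ e3OfK Lc G_0 S l t` is additive and homogeneous on such families, every sector's two-leg pairing against the bounded weights `n ⊗ dzφ` is absolutely summable and UNIFORMLY
bounded in the slot (§1 — the pushed family `e3OfK Lc G_0 S` is again local), so the pair sum and the slot sum (against a direction-wise summable `h`) split sector by sector (§2–§3).
The sequel `SourcePairingLevelOneClosed` evaluates the three sectors: the Wilson sector by leaf-02 g61's PART 4b `WilsonSectorSourcePairingZero`, the border sector by their PART 2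
`BorderSectorSourcePairingSucc`, the Lagrange sector by TODAY's `LambdaSectorSourcePairingZero` (= 0 for two-level data), and assembles them at Bałaban's pins.
* §1 `abs_legPairing_le` (two-leg pairing of ANY local stencil family against bounded `n ⊗ dzφ`: summable, uniformly bounded in the slot), `summable_slot_mul_legPairing`.
* §2 `e3OfK_eq_e3K'` (an2's `e3OfK` IS `ThirdJetKernel.e3K`, `rfl`), **`e3OfK_S0NAt_eq_sectors`** (per slot, as kernels), **`legPairing_S0NAt_eq_sectors`** (per slot, pair sums).
* §3 **`slotSum_S0NAt_eq_sectors`** — the statement in the title (in-block root, every weight triple, `h` direction-wise summable, bounded `n`, bounded `φ`).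
Asserts NO value of any resolvent column; the values of the three sectors and the pin assembly are NOT here; NOTHING of `hX` ∕ (W-γ) at levels ≥ 1 ∕ (INV) ∕ (S) discharged; NEVER
«G-an2-4 closed» as (CONV-C); NOT D1, NOT `BetaPertH`, NOT continuum, NOT Clay.  2026-08-23; no existing file touched.
-/

noncomputable section

open Finset
open scoped BigOperators
open Literature.MathematicalPhysics.QuantumFieldTheory
open Literature.MathematicalPhysics.QuantumFieldTheory.Balaban1983to89
open Literature.MathematicalPhysics.QuantumFieldTheory.Balaban1983to89.Beta
open B12Sec2to5 (l1 l1_nonneg)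
open ExpKernelCalculus (Site MKer BiLoc Decays Zl Zl_nonneg summable_exp_shift' tsum_exp_shift')
open OneStepResolventKernel (Fib LocStencil KInv)
open AffineAveraging (Form1 box toSite unitVec dz)
open AveragingHessianKernels (ell)
open AveragingHessianKernelsRooted (vhSAt locStencil_vhSAt hessFFAt)
open InterLevelTransport (SLam)
open StepJetData (wilsonA wBound locStencil_wilsonA locStencil_add locStencil_smul)
open OneStepKernelFamily (KInvStep colH)
open BalabanStepJets (lamCoeffOf)
open BalabanStepJetsSucc (E2 lamCoeffK)
open Summit.QuantumFields.BalabanUV.Beta.AxialDressingRooted (coDressKBmAt decays_coDressKBmAt_KInvStep one_le_of_neZero)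
open Summit.QuantumFields.BalabanUV.Beta.SpineRooted (S0NAt e3OfK e3OfK_apply locStencil_e3OfK)
open Summit.QuantumFields.BalabanUV.Beta.GAN24.ThirdJetKernel (e3K e3K_smul)
open Summit.QuantumFields.BalabanUV.Beta.GAN24.SrecLinearPartEq (e3K_add)
open Summit.QuantumFields.BalabanUV.Beta.GAN24.CoarseGaugeSourceResponse (summable_bdd_mul)
open Summit.QuantumFields.BalabanUV.Beta.GAN24.LambdaMemberPairing (locStencil_SLam_lamCoeffK)
open Summit.QuantumFields.BalabanUV.Beta.GAN24.LambdaSectorSourcePairingZero (SLam_lamCoeffOf_eq_SLam_lamCoeffK_zero)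

namespace Summit.QuantumFields.BalabanUV.Beta.GAN24.SourcePairingLevelOneSectors

variable {d : ℕ}

/-! ## §1 The two-leg pairing of a local stencil family against bounded weights -/

/-- NOT IN PRINT; OUR BOOKKEEPING.  **THE TWO-LEG PAIRING OF A LOCAL STENCIL FAMILY AGAINST BOUNDED WEIGHTS IS SUMMABLE AND UNIFORMLY BOUNDED IN THE SLOT**: for `LocStencil T CT δT`,
`δT > 0`, `|n| ≤ Bn`, `|φ| ≤ Bφ`, the family `(u,x) ↦ Σ_κ Σ_κ₂ n κ u·dzφ κ₂ x·T l t u x (inl κ)(inl κ₂)` is summable with `|Σ'_{(u,x)} …| ≤ (d+1)²·Bn·2Bφ·CT·Zl(δT)²` for every slot. -/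
theorem abs_legPairing_le {T : Fin (d + 1) → Site (d + 1) → MKer (d + 1) (Fib d)} {CT δT : ℝ} (hT : LocStencil T CT δT) (hδT : 0 < δT)
    {n : Form1 (d + 1) ℝ} {Bn : ℝ} (hn : ∀ κ u, |n κ u| ≤ Bn) {φ : Site (d + 1) → ℝ} {Bφ : ℝ} (hφ : ∀ y, |φ y| ≤ Bφ) :
    ∃ B : ℝ, 0 ≤ B ∧ ∀ (l : Fin (d + 1)) (t : Site (d + 1)),
      (Summable fun ux : Site (d + 1) × Site (d + 1) => ∑ κ, ∑ κ₂, n κ ux.1 * dz φ κ₂ ux.2 * T l t ux.1 ux.2 (Sum.inl κ) (Sum.inl κ₂)) ∧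
      |∑' ux : Site (d + 1) × Site (d + 1), ∑ κ, ∑ κ₂, n κ ux.1 * dz φ κ₂ ux.2 * T l t ux.1 ux.2 (Sum.inl κ) (Sum.inl κ₂)| ≤ B := by
  classical
  have hBn : 0 ≤ Bn := (abs_nonneg _).trans (hn 0 0)
  have hBφ : 0 ≤ Bφ := (abs_nonneg _).trans (hφ 0)
  have hgb : ∀ a w, |dz φ a w| ≤ 2 * Bφ := KKTFluctuationEnergy.abs_dz_le hφ
  have hCT : 0 ≤ CT := (hT 0 0).nonneg (Sum.inl 0)
  set M : ℝ := ((d + 1 : ℕ) : ℝ) * (((d + 1 : ℕ) : ℝ) * (Bn * (2 * Bφ) * CT)) with hM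
  have hM0 : 0 ≤ M := by positivity
  refine ⟨M * (Zl (d + 1) δT * Zl (d + 1) δT), by have := Zl_nonneg (D := d + 1) hδT; positivity, fun l t => ?_⟩
  set F : Site (d + 1) × Site (d + 1) → ℝ := fun ux => ∑ κ, ∑ κ₂, n κ ux.1 * dz φ κ₂ ux.2 * T l t ux.1 ux.2 (Sum.inl κ) (Sum.inl κ₂) with hF
  set g : Site (d + 1) × Site (d + 1) → ℝ := fun ux => M * (Real.exp (-δT * l1 (ux.1 - t)) * Real.exp (-δT * l1 (ux.2 - t))) with hg
  have hmaj : HasSum g (M * (Zl (d + 1) δT * Zl (d + 1) δT)) := by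
    have h1 := summable_exp_shift' (D := d + 1) hδT t
    have h12 := h1.hasSum.mul h1.hasSum (h1.mul_of_nonneg h1 (fun _ => (Real.exp_pos _).le) (fun _ => (Real.exp_pos _).le))
    simp only [tsum_exp_shift'] at h12
    exact h12.mul_left M
  have hterm : ∀ (ux : Site (d + 1) × Site (d + 1)) (κ κ₂ : Fin (d + 1)),
      |n κ ux.1 * dz φ κ₂ ux.2 * T l t ux.1 ux.2 (Sum.inl κ) (Sum.inl κ₂)| ≤ Bn * (2 * Bφ) * (CT * (Real.exp (-δT * l1 (ux.1 - t)) * Real.exp (-δT * l1 (ux.2 - t)))) := by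
    intro ux κ κ₂
    rw [abs_mul, abs_mul]
    have e3 : |T l t ux.1 ux.2 (Sum.inl κ) (Sum.inl κ₂)| ≤ CT * (Real.exp (-δT * l1 (ux.1 - t)) * Real.exp (-δT * l1 (ux.2 - t))) := by
      have := hT l t ux.1 ux.2 (Sum.inl κ) (Sum.inl κ₂)
      rwa [mul_add, Real.exp_add] at this
    exact mul_le_mul (mul_le_mul (hn κ ux.1) (hgb κ₂ ux.2) (abs_nonneg _) hBn) e3 (abs_nonneg _) (by positivity)
  have hle : ∀ ux : Site (d + 1) × Site (d + 1), |F ux| ≤ g ux := by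
    intro ux
    calc |F ux| ≤ ∑ κ : Fin (d + 1), |∑ κ₂ : Fin (d + 1), n κ ux.1 * dz φ κ₂ ux.2 * T l t ux.1 ux.2 (Sum.inl κ) (Sum.inl κ₂)| := Finset.abs_sum_le_sum_abs _ _
      _ ≤ ∑ κ : Fin (d + 1), ∑ κ₂ : Fin (d + 1), |n κ ux.1 * dz φ κ₂ ux.2 * T l t ux.1 ux.2 (Sum.inl κ) (Sum.inl κ₂)| :=
          Finset.sum_le_sum fun κ _ => Finset.abs_sum_le_sum_abs _ _
      _ ≤ ∑ _κ : Fin (d + 1), ∑ _κ₂ : Fin (d + 1), Bn * (2 * Bφ) * (CT * (Real.exp (-δT * l1 (ux.1 - t)) * Real.exp (-δT * l1 (ux.2 - t)))) :=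
          Finset.sum_le_sum fun κ _ => Finset.sum_le_sum fun κ₂ _ => hterm ux κ κ₂
      _ = g ux := by simp only [Finset.sum_const, Finset.card_univ, Fintype.card_fin, nsmul_eq_mul, hg, hM]; ring
  have hsF : Summable F := Summable.of_norm_bounded hmaj.summable (fun ux => by rw [Real.norm_eq_abs]; exact hle ux)
  refine ⟨hsF, ?_⟩
  calc |∑' ux : Site (d + 1) × Site (d + 1), F ux| ≤ ∑' ux : Site (d + 1) × Site (d + 1), |F ux| := by
        have h := norm_tsum_le_tsum_norm hsF.norm
        simpa only [Real.norm_eq_abs] using h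
    _ ≤ ∑' ux : Site (d + 1) × Site (d + 1), g ux := hsF.abs.tsum_le_tsum hle hmaj.summable
    _ = _ := hmaj.tsum_eq

/-- [folklore] Hence, against a slot datum summable along every direction, the slot family `t ↦ h l t·(pair sum at (l,t))` is summable. -/
theorem summable_slot_mul_legPairing {T : Fin (d + 1) → Site (d + 1) → MKer (d + 1) (Fib d)} {CT δT : ℝ} (hT : LocStencil T CT δT) (hδT : 0 < δT)
    {n : Form1 (d + 1) ℝ} {Bn : ℝ} (hn : ∀ κ u, |n κ u| ≤ Bn) {φ : Site (d + 1) → ℝ} {Bφ : ℝ} (hφ : ∀ y, |φ y| ≤ Bφ)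
    {h : Form1 (d + 1) ℝ} (hh : ∀ l, Summable (h l)) (l : Fin (d + 1)) :
    Summable fun t : Site (d + 1) => h l t * ∑' ux : Site (d + 1) × Site (d + 1), ∑ κ, ∑ κ₂, n κ ux.1 * dz φ κ₂ ux.2 * T l t ux.1 ux.2 (Sum.inl κ) (Sum.inl κ₂) := by
  obtain ⟨B, -, hB⟩ := abs_legPairing_le hT hδT hn hφ
  exact (summable_bdd_mul (hh l) (fun t => (hB l t).2)).congr fun t => by ring

/-! ## §2 The cubic functional of `S0NAt` splits into its three sectors, per slot -/

/-- [folklore] an2's `e3OfK N K S` IS `ThirdJetKernel.e3K K N S` (same term, argument order). -/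
theorem e3OfK_eq_e3K' (N : ℕ) (K : MKer (d + 1) (Fib d)) (S : Fin (d + 1) → Site (d + 1) → MKer (d + 1) (Fib d)) :
    e3OfK N K S = e3K K N S := by
  funext κ' u' x' z' a b
  rw [e3OfK_apply]
  rfl

section Step

variable {Lc : ℕ} [NeZero Lc] {r : Fin (d + 1) → ℕ}

/-- NOT IN PRINT; OUR BOOKKEEPING.  **THE CUBIC FUNCTIONAL OF `S0NAt` SPLITS INTO ITS THREE SECTORS** (in-block root `ρ = toSite r`, every weight triple, every slot; `G_0 = coDressKBmAt ρ Lc (KInvStep Lc 0)`,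
the Lagrange member written in the `lamCoeffK` letters of `SrecAt`'s higher members):
`e3OfK Lc G_0 (S0NAt ρ cE cVH cΛ) l t = cE • e3OfK Lc G_0 wilsonA l t + cVH • e3OfK Lc G_0 (vhSAt ρ) l t + cΛ • e3OfK Lc G_0 (SLam Lc (lamCoeffK (KInvStep Lc 0) (E2 0) Lc) (hessFFAt ρ)) l t`. -/
theorem e3OfK_S0NAt_eq_sectors (hr : r ∈ box (d + 1) Lc) (cE cVH cΛ : ℝ) (l : Fin (d + 1)) (t : Site (d + 1)) :
    e3OfK Lc (coDressKBmAt (toSite r) Lc (KInvStep (d := d) Lc 0)) (S0NAt d Lc (toSite r) cE cVH cΛ) l t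
      = cE • e3OfK Lc (coDressKBmAt (toSite r) Lc (KInvStep (d := d) Lc 0)) (wilsonA d) l t
        + cVH • e3OfK Lc (coDressKBmAt (toSite r) Lc (KInvStep (d := d) Lc 0)) (fun κ' u' => vhSAt (toSite r) d Lc rfl κ' u') l t
        + cΛ • e3OfK Lc (coDressKBmAt (toSite r) Lc (KInvStep (d := d) Lc 0))
            (SLam Lc (lamCoeffK (KInvStep (d := d) Lc 0) (E2 d Lc 0) Lc) (fun μ y => hessFFAt (toSite r) Lc μ y)) l t := by
  have hLc : 1 ≤ Lc := one_le_of_neZero Lc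
  obtain ⟨δG, CG, hδG, hCG, hG⟩ := decays_coDressKBmAt_KInvStep (d := d) hr 0
  -- the three members are local (common rate for the first two, its own rate for the third)
  have h1 : LocStencil (fun κ' u' => cE • wilsonA d κ' u') (|cE| * (wBound d * Real.exp (4 * 1))) 1 := locStencil_smul cE (locStencil_wilsonA (d := d) zero_le_one)
  have h2 : LocStencil (fun κ' u' => cVH • vhSAt (toSite r) d Lc rfl κ' u') (|cVH| * (3 * (ell (d + 1) Lc : ℝ) ^ 2 * Real.exp (4 * ((d : ℝ) + 1) * Lc * 1))) 1 :=
    locStencil_smul cVH (locStencil_vhSAt hLc hr zero_le_one)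
  have h12 := locStencil_add h1 h2
  obtain ⟨Cs, δs, hδs, h3⟩ := locStencil_SLam_lamCoeffK (d := d) hr 0
  have h3' := locStencil_smul cΛ h3
  -- unfold `S0NAt`, re-letter its Lagrange member, and split
  have hS0 : S0NAt d Lc (toSite r) cE cVH cΛ = fun κ' u' =>
      (cE • wilsonA d κ' u' + cVH • vhSAt (toSite r) d Lc rfl κ' u')
        + cΛ • SLam Lc (lamCoeffK (KInvStep (d := d) Lc 0) (E2 d Lc 0) Lc) (fun μ y => hessFFAt (toSite r) Lc μ y) κ' u' := by
    funext κ' u'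
    rw [← SLam_lamCoeffOf_eq_SLam_lamCoeffK_zero]
    rfl
  rw [hS0]
  simp only [e3OfK_eq_e3K']
  rw [e3K_add hG hδG Lc h12 h3' one_pos hδs l t, e3K_add hG hδG Lc h1 h2 one_pos one_pos l t, e3K_smul, e3K_smul, e3K_smul]

/-- NOT IN PRINT; OUR BOOKKEEPING.  **THE TWO-LEG PAIRING AT LEVEL ONE SPLITS INTO ITS THREE SECTORS, PER SLOT** (in-block root, every weight triple, every slot, bounded `n`, bounded `φ`):
`Σ'_{(u,x)} Σ_κκ₂ n κ u·dzφ κ₂ x·e3OfK Lc G_0 (S0NAt ρ cE cVH cΛ) l t u x (inl κ)(inl κ₂) = cE·(same with wilsonA) + cVH·(same with vhSAt ρ) + cΛ·(same with the Lagrange member)`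
— §2 per entry, and each sector's pair family is summable (§1: the pushed family `e3OfK Lc G_0 S` is local, `locStencil_e3OfK`). -/
theorem legPairing_S0NAt_eq_sectors (hr : r ∈ box (d + 1) Lc) (cE cVH cΛ : ℝ) (l : Fin (d + 1)) (t : Site (d + 1))
    {n : Form1 (d + 1) ℝ} {Bn : ℝ} (hn : ∀ κ u, |n κ u| ≤ Bn) {φ : Site (d + 1) → ℝ} {Bφ : ℝ} (hφ : ∀ y, |φ y| ≤ Bφ) :
    ∑' ux : Site (d + 1) × Site (d + 1), ∑ κ, ∑ κ₂, n κ ux.1 * dz φ κ₂ ux.2 *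
        e3OfK Lc (coDressKBmAt (toSite r) Lc (KInvStep (d := d) Lc 0)) (S0NAt d Lc (toSite r) cE cVH cΛ) l t ux.1 ux.2 (Sum.inl κ) (Sum.inl κ₂)
      = cE * ∑' ux : Site (d + 1) × Site (d + 1), ∑ κ, ∑ κ₂, n κ ux.1 * dz φ κ₂ ux.2 *
            e3OfK Lc (coDressKBmAt (toSite r) Lc (KInvStep (d := d) Lc 0)) (wilsonA d) l t ux.1 ux.2 (Sum.inl κ) (Sum.inl κ₂)
        + cVH * ∑' ux : Site (d + 1) × Site (d + 1), ∑ κ, ∑ κ₂, n κ ux.1 * dz φ κ₂ ux.2 *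
            e3OfK Lc (coDressKBmAt (toSite r) Lc (KInvStep (d := d) Lc 0)) (fun κ' u' => vhSAt (toSite r) d Lc rfl κ' u') l t ux.1 ux.2 (Sum.inl κ) (Sum.inl κ₂)
        + cΛ * ∑' ux : Site (d + 1) × Site (d + 1), ∑ κ, ∑ κ₂, n κ ux.1 * dz φ κ₂ ux.2 *
            e3OfK Lc (coDressKBmAt (toSite r) Lc (KInvStep (d := d) Lc 0))
              (SLam Lc (lamCoeffK (KInvStep (d := d) Lc 0) (E2 d Lc 0) Lc) (fun μ y => hessFFAt (toSite r) Lc μ y)) l t ux.1 ux.2 (Sum.inl κ) (Sum.inl κ₂) := by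
  classical
  have hLc : 1 ≤ Lc := one_le_of_neZero Lc
  obtain ⟨δG, CG, hδG, hCG, hG⟩ := decays_coDressKBmAt_KInvStep (d := d) hr 0
  set G : MKer (d + 1) (Fib d) := coDressKBmAt (toSite r) Lc (KInvStep (d := d) Lc 0) with hGdef
  -- the three pushed families are local
  obtain ⟨C1, δ1, hδ1, hT1⟩ := locStencil_e3OfK (N := Lc) hLc ⟨δG, CG, hδG, hCG, hG⟩ (locStencil_wilsonA (d := d) zero_le_one) one_pos
  obtain ⟨C2, δ2, hδ2, hT2⟩ := locStencil_e3OfK (N := Lc) hLc ⟨δG, CG, hδG, hCG, hG⟩ (locStencil_vhSAt hLc hr zero_le_one) one_pos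
  obtain ⟨Cs, δs, hδs, h3⟩ := locStencil_SLam_lamCoeffK (d := d) hr 0
  obtain ⟨C3, δ3, hδ3, hT3⟩ := locStencil_e3OfK (N := Lc) hLc ⟨δG, CG, hδG, hCG, hG⟩ h3 hδs
  obtain ⟨B1, -, hB1⟩ := abs_legPairing_le hT1 hδ1 hn hφ
  obtain ⟨B2, -, hB2⟩ := abs_legPairing_le hT2 hδ2 hn hφ
  obtain ⟨B3, -, hB3⟩ := abs_legPairing_le hT3 hδ3 hn hφ
  have hs1 := (hB1 l t).1
  have hs2 := (hB2 l t).1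
  have hs3 := (hB3 l t).1
  -- pointwise split of the summand
  have hpt : ∀ ux : Site (d + 1) × Site (d + 1), (∑ κ, ∑ κ₂, n κ ux.1 * dz φ κ₂ ux.2 *
        e3OfK Lc G (S0NAt d Lc (toSite r) cE cVH cΛ) l t ux.1 ux.2 (Sum.inl κ) (Sum.inl κ₂))
      = cE * (∑ κ, ∑ κ₂, n κ ux.1 * dz φ κ₂ ux.2 * e3OfK Lc G (wilsonA d) l t ux.1 ux.2 (Sum.inl κ) (Sum.inl κ₂))
        + cVH * (∑ κ, ∑ κ₂, n κ ux.1 * dz φ κ₂ ux.2 * e3OfK Lc G (fun κ' u' => vhSAt (toSite r) d Lc rfl κ' u') l t ux.1 ux.2 (Sum.inl κ) (Sum.inl κ₂))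
        + cΛ * (∑ κ, ∑ κ₂, n κ ux.1 * dz φ κ₂ ux.2 *
            e3OfK Lc G (SLam Lc (lamCoeffK (KInvStep (d := d) Lc 0) (E2 d Lc 0) Lc) (fun μ y => hessFFAt (toSite r) Lc μ y)) l t ux.1 ux.2 (Sum.inl κ) (Sum.inl κ₂)) := by
    intro ux
    rw [hGdef, e3OfK_S0NAt_eq_sectors hr cE cVH cΛ l t]
    simp only [Pi.add_apply, Pi.smul_apply, smul_eq_mul, Finset.mul_sum]
    rw [← Finset.sum_add_distrib, ← Finset.sum_add_distrib]
    refine Finset.sum_congr rfl fun κ _ => ?_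
    rw [← Finset.sum_add_distrib, ← Finset.sum_add_distrib]
    refine Finset.sum_congr rfl fun κ₂ _ => ?_
    ring
  rw [tsum_congr hpt, ((hs1.mul_left cE).add (hs2.mul_left cVH)).tsum_add (hs3.mul_left cΛ), (hs1.mul_left cE).tsum_add (hs2.mul_left cVH),
    tsum_mul_left, tsum_mul_left, tsum_mul_left]

/-! ## §3 The slot sum splits -/

/-- NOT IN PRINT; OUR BOOKKEEPING.  **THE SOURCE PAIRING AT LEVEL ONE SPLITS INTO ITS THREE SECTORS** (in-block root `ρ = toSite r`, every weight triple `cE cVH cΛ`, `h` summable along every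
direction, bounded `n`, bounded `φ`; `G_0 = coDressKBmAt ρ Lc (KInvStep Lc 0)`, `X_1(h; n, φ)[S] := Σ_l Σ'_t h l t·Σ'_{(u,x)} Σ_κκ₂ n κ u·dzφ κ₂ x·e3OfK Lc G_0 S l t u x (inl κ)(inl κ₂)`):
`X_1(h; n, φ)[S0NAt ρ cE cVH cΛ] = cE·X_1[wilsonA] + cVH·X_1[vhSAt ρ] + cΛ·X_1[SLam Lc (lamCoeffK (KInvStep Lc 0) (E2 0) Lc) (hessFFAt ρ)]` — §2 per slot, §1 for the summability of
every sector's slot family. -/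
theorem slotSum_S0NAt_eq_sectors (hr : r ∈ box (d + 1) Lc) (cE cVH cΛ : ℝ)
    {h : Form1 (d + 1) ℝ} (hh : ∀ l, Summable (h l)) {n : Form1 (d + 1) ℝ} {Bn : ℝ} (hn : ∀ κ u, |n κ u| ≤ Bn)
    {φ : Site (d + 1) → ℝ} {Bφ : ℝ} (hφ : ∀ y, |φ y| ≤ Bφ) :
    ∑ l, ∑' t : Site (d + 1), h l t * ∑' ux : Site (d + 1) × Site (d + 1), ∑ κ, ∑ κ₂, n κ ux.1 * dz φ κ₂ ux.2 *
        e3OfK Lc (coDressKBmAt (toSite r) Lc (KInvStep (d := d) Lc 0)) (S0NAt d Lc (toSite r) cE cVH cΛ) l t ux.1 ux.2 (Sum.inl κ) (Sum.inl κ₂)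
      = cE * ∑ l, ∑' t : Site (d + 1), h l t * ∑' ux : Site (d + 1) × Site (d + 1), ∑ κ, ∑ κ₂, n κ ux.1 * dz φ κ₂ ux.2 *
            e3OfK Lc (coDressKBmAt (toSite r) Lc (KInvStep (d := d) Lc 0)) (wilsonA d) l t ux.1 ux.2 (Sum.inl κ) (Sum.inl κ₂)
        + cVH * ∑ l, ∑' t : Site (d + 1), h l t * ∑' ux : Site (d + 1) × Site (d + 1), ∑ κ, ∑ κ₂, n κ ux.1 * dz φ κ₂ ux.2 *
            e3OfK Lc (coDressKBmAt (toSite r) Lc (KInvStep (d := d) Lc 0)) (fun κ' u' => vhSAt (toSite r) d Lc rfl κ' u') l t ux.1 ux.2 (Sum.inl κ) (Sum.inl κ₂)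
        + cΛ * ∑ l, ∑' t : Site (d + 1), h l t * ∑' ux : Site (d + 1) × Site (d + 1), ∑ κ, ∑ κ₂, n κ ux.1 * dz φ κ₂ ux.2 *
            e3OfK Lc (coDressKBmAt (toSite r) Lc (KInvStep (d := d) Lc 0))
              (SLam Lc (lamCoeffK (KInvStep (d := d) Lc 0) (E2 d Lc 0) Lc) (fun μ y => hessFFAt (toSite r) Lc μ y)) l t ux.1 ux.2 (Sum.inl κ) (Sum.inl κ₂) := by
  classical
  have hLc : 1 ≤ Lc := one_le_of_neZero Lc
  obtain ⟨δG, CG, hδG, hCG, hG⟩ := decays_coDressKBmAt_KInvStep (d := d) hr 0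
  set G : MKer (d + 1) (Fib d) := coDressKBmAt (toSite r) Lc (KInvStep (d := d) Lc 0) with hGdef
  obtain ⟨C1, δ1, hδ1, hT1⟩ := locStencil_e3OfK (N := Lc) hLc ⟨δG, CG, hδG, hCG, hG⟩ (locStencil_wilsonA (d := d) zero_le_one) one_pos
  obtain ⟨C2, δ2, hδ2, hT2⟩ := locStencil_e3OfK (N := Lc) hLc ⟨δG, CG, hδG, hCG, hG⟩ (locStencil_vhSAt hLc hr zero_le_one) one_pos
  obtain ⟨Cs, δs, hδs, h3⟩ := locStencil_SLam_lamCoeffK (d := d) hr 0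
  obtain ⟨C3, δ3, hδ3, hT3⟩ := locStencil_e3OfK (N := Lc) hLc ⟨δG, CG, hδG, hCG, hG⟩ h3 hδs
  set FW : Fin (d + 1) → Site (d + 1) → ℝ := fun l t => ∑' ux : Site (d + 1) × Site (d + 1), ∑ κ, ∑ κ₂, n κ ux.1 * dz φ κ₂ ux.2 *
      e3OfK Lc G (wilsonA d) l t ux.1 ux.2 (Sum.inl κ) (Sum.inl κ₂) with hFW
  set FV : Fin (d + 1) → Site (d + 1) → ℝ := fun l t => ∑' ux : Site (d + 1) × Site (d + 1), ∑ κ, ∑ κ₂, n κ ux.1 * dz φ κ₂ ux.2 *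
      e3OfK Lc G (fun κ' u' => vhSAt (toSite r) d Lc rfl κ' u') l t ux.1 ux.2 (Sum.inl κ) (Sum.inl κ₂) with hFV
  set FL : Fin (d + 1) → Site (d + 1) → ℝ := fun l t => ∑' ux : Site (d + 1) × Site (d + 1), ∑ κ, ∑ κ₂, n κ ux.1 * dz φ κ₂ ux.2 *
      e3OfK Lc G (SLam Lc (lamCoeffK (KInvStep (d := d) Lc 0) (E2 d Lc 0) Lc) (fun μ y => hessFFAt (toSite r) Lc μ y)) l t ux.1 ux.2 (Sum.inl κ) (Sum.inl κ₂) with hFL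
  have hsW : ∀ l, Summable fun t : Site (d + 1) => h l t * FW l t := fun l => summable_slot_mul_legPairing hT1 hδ1 hn hφ hh l
  have hsV : ∀ l, Summable fun t : Site (d + 1) => h l t * FV l t := fun l => summable_slot_mul_legPairing hT2 hδ2 hn hφ hh l
  have hsL : ∀ l, Summable fun t : Site (d + 1) => h l t * FL l t := fun l => summable_slot_mul_legPairing hT3 hδ3 hn hφ hh l
  -- per slot
  have hslot : ∀ (l : Fin (d + 1)) (t : Site (d + 1)), h l t * (∑' ux : Site (d + 1) × Site (d + 1), ∑ κ, ∑ κ₂, n κ ux.1 * dz φ κ₂ ux.2 *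
        e3OfK Lc G (S0NAt d Lc (toSite r) cE cVH cΛ) l t ux.1 ux.2 (Sum.inl κ) (Sum.inl κ₂))
      = cE * (h l t * FW l t) + cVH * (h l t * FV l t) + cΛ * (h l t * FL l t) := by
    intro l t
    rw [hGdef, legPairing_S0NAt_eq_sectors hr cE cVH cΛ l t hn hφ]
    ring
  show (∑ l, ∑' t : Site (d + 1), h l t * ∑' ux : Site (d + 1) × Site (d + 1), ∑ κ, ∑ κ₂, n κ ux.1 * dz φ κ₂ ux.2 *
        e3OfK Lc G (S0NAt d Lc (toSite r) cE cVH cΛ) l t ux.1 ux.2 (Sum.inl κ) (Sum.inl κ₂))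
      = cE * ∑ l, ∑' t : Site (d + 1), h l t * FW l t + cVH * ∑ l, ∑' t : Site (d + 1), h l t * FV l t + cΛ * ∑ l, ∑' t : Site (d + 1), h l t * FL l t
  have e1 : ∀ l, (∑' t : Site (d + 1), h l t * ∑' ux : Site (d + 1) × Site (d + 1), ∑ κ, ∑ κ₂, n κ ux.1 * dz φ κ₂ ux.2 *
        e3OfK Lc G (S0NAt d Lc (toSite r) cE cVH cΛ) l t ux.1 ux.2 (Sum.inl κ) (Sum.inl κ₂))
      = cE * ∑' t : Site (d + 1), h l t * FW l t + cVH * ∑' t : Site (d + 1), h l t * FV l t + cΛ * ∑' t : Site (d + 1), h l t * FL l t := by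
    intro l
    rw [tsum_congr (hslot l), (((hsW l).mul_left cE).add ((hsV l).mul_left cVH)).tsum_add ((hsL l).mul_left cΛ),
      ((hsW l).mul_left cE).tsum_add ((hsV l).mul_left cVH), tsum_mul_left, tsum_mul_left, tsum_mul_left]
  rw [Finset.sum_congr rfl fun l _ => e1 l, Finset.sum_add_distrib, Finset.sum_add_distrib, ← Finset.mul_sum, ← Finset.mul_sum, ← Finset.mul_sum]

end Step

end Summit.QuantumFields.BalabanUV.Beta.GAN24.SourcePairingLevelOneSectors

end
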